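import Mathlib
import HarnessLib
import Summits.NavierStokesRegularity.NavierStokesRegularity.Theses.LevelSetModeration
import Summits.NavierStokesRegularity.NavierStokesRegularity.Theorems.LevelSetModerationHighSpeedPressureWorkConsequences
import Summits.NavierStokesRegularity.NavierStokesRegularity.Theorems.LevelSetModerationLevelSetEnergyInequality
import Summits.NavierStokesRegularity.NavierStokesRegularity.Theorems.LevelSetModerationLevelSetClosureSliceGain
import Summits.NavierStokesRegularity.NavierStokesRegularity.Theorems.LevelSetModerationLevelSetClosureStampacchia
import Summits.NavierStokesRegularity.NavierStokesRegularity.Theorems.LevelSetModerationLevelSetClosureTools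

/-!
# Route LevelSetModeration — crux 3 `LevelSetClosure` (stmt-NavierStokesRegularity-18150)

**The De Giorgi closure for the speed.** If a classical Leray–Hopf solution `u` from a rapidly
decaying datum with `|u₀| ≤ M₀/2` obeys the pressure-work bound of crux 2 with some modulus `Λ`
and exponent `m < 10/3` on every window `M ≥ M₀`, `c ∈ [M/2, M]`, then `u` is bounded on `[0,T)`.

Proof (Vasseur 2007, §4, in the space–time-VOLUME bookkeeping of De Giorgi 1957): write
`V(c) = ∫₀ᵀ |{|u(τ)| > c}| dτ`, `D(c) = ∫₀ᵀ∫ 1_{|u|>c} |∇|u||²`, `E_c(t) = ∫ (|u(t)| − c)₊²`.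
* De Giorgi input (landed, `levelSetEnergy_le_of_pairingBound` with the PROVED route item
  `LevelSetEnergyInequality`): on a window, `ν² D(c) ≤ Λ₊ M^m V(c)` and
  `E_c(t) ≤ 4 Λ₊ M^m V(c) / ν`.
* Two-level Chebyshev–Sobolev gain for one slice (`sliceVolumeGain`: `C¹` truncation of the
  speed, Chebyshev on `L^{10/3}`, Hölder `10/3 = (2/5)·2 ⊕ (3/5)·6`, whole-space GNS
  `eLpNorm_six_le_eLpNorm_fderiv_two`), integrated in time (`levelVolume_twoLevel_le`):
  `V(h) ≤ (4/(h−k))^{10/3} K² (sup_τ E_k(τ))^{2/3} D(k)`.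
* Hence the AUTONOMOUS two-level gain `V(h) ≤ C(M) (h−k)^{-10/3} V(k)^{5/3}`,
  `C(M) ∝ Λ₊^{5/3} ν^{-8/3} M^{5m/3}`, on `[M/2, M]`; the base `V(M/2) ≲ M^{-10/3}` is ONE Sobolev
  step from level `M/4` with the Leray–Hopf-uniform bounds `E ≤ ‖u₀‖₂²`, `ν D ≤ ½‖u₀‖₂²`
  (`levelSetDissipation_ne_top`); the Stampacchia threshold is `∝ M^{(5/3)(m − 10/3)} → 0`.
* Stampacchia's lemma (from the landed `IterationLemma`) gives `V(M) = 0` for `M` large; an open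
  space–time super-level set of the jointly continuous `u` with zero volume is empty.

References: A. Vasseur, NoDEA 14 (2007), Lemma 4, Lemma 11, §4 [Vasseur2007];
E. De Giorgi (1957); D. Kinderlehrer–G. Stampacchia, *Variational inequalities*, II Lemma B.1.
-/

noncomputable section

-- single-conjunct summit: `Summit.<Summit>.<Problem>` repeats the name by the D-0017 layout
set_option linter.dupNamespace false

namespace Summit.NavierStokesRegularity.NavierStokesRegularity.Theorems

open MeasureTheory Set Filter Topology Function
open scoped ENNReal NNReal
open Literature.Analysis.FluidPDE
open Summit.NavierStokesRegularity.NavierStokesRegularity.Theses.LevelSetModeration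

/-! ### Leray–Hopf bounds: slice energies and the level-set volume -/

/-- Every slice `u t`, `t ∈ [0,T]`, of an unforced Leray–Hopf solution with `ν ≥ 0` has
`‖u t‖² ∈ L¹` and `∫ ‖u t‖² ≤ ∫ ‖u 0‖²` (the energy inequality from `s = 0`, dissipation dropped).
[folklore] -/
theorem integral_norm_sq_le_of_lerayHopf {ν T : ℝ}
    {u : ℝ → EuclideanSpace ℝ (Fin 3) → EuclideanSpace ℝ (Fin 3)}
    (hLH : IsLerayHopfOn T ν 0 (u 0) u) (hν : 0 ≤ ν) {t : ℝ} (ht : t ∈ Icc 0 T) :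
    Integrable (fun x => ‖u t x‖ ^ 2) ∧ ∫ x, ‖u t x‖ ^ 2 ≤ ∫ x, ‖u 0 x‖ ^ 2 := by
  refine ⟨(hLH.memLp t ht).integrable_norm_pow two_ne_zero, ?_⟩
  obtain ⟨G, -, -, hE, -⟩ := hLH.weakGrad_energy
  have h := hE t ht
  simp only [Pi.zero_apply, inner_zero_left, integral_zero, intervalIntegral.integral_zero,
    add_zero] at h
  have hd : 0 ≤ ν * (∫⁻ τ in Ioo 0 t, ∫⁻ x, ENNReal.ofReal (frobeniusNormSq (G τ x))).toReal :=
    mul_nonneg hν ENNReal.toReal_nonneg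
  have h2 : VectorCalculus.kineticEnergy (u t) ≤ VectorCalculus.kineticEnergy (u 0) := by
    linarith
  unfold VectorCalculus.kineticEnergy at h2
  linarith

/-- `∫⁻ ‖u t‖ₑ² ≤ ofReal (∫ ‖u 0‖²)` for every `t ∈ [0,T]` (extended form of
`integral_norm_sq_le_of_lerayHopf`). [folklore] -/
theorem lintegral_enorm_sq_le_of_lerayHopf {ν T : ℝ}
    {u : ℝ → EuclideanSpace ℝ (Fin 3) → EuclideanSpace ℝ (Fin 3)}
    (hLH : IsLerayHopfOn T ν 0 (u 0) u) (hν : 0 ≤ ν) {t : ℝ} (ht : t ∈ Icc 0 T) :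
    ∫⁻ x, ‖u t x‖ₑ ^ 2 ≤ ENNReal.ofReal (∫ x, ‖u 0 x‖ ^ 2) := by
  obtain ⟨hint, hle⟩ := integral_norm_sq_le_of_lerayHopf hLH hν ht
  have heq : ENNReal.ofReal (∫ x, ‖u t x‖ ^ 2) = ∫⁻ x, ‖u t x‖ₑ ^ 2 := by
    rw [ofReal_integral_eq_lintegral_ofReal hint (ae_of_all _ fun x => sq_nonneg _)]
    exact lintegral_congr fun x => by rw [← ofReal_norm, ENNReal.ofReal_pow (norm_nonneg _)]
  rw [← heq]
  exact ENNReal.ofReal_le_ofReal hle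

/-- **Chebyshev for the speed level sets.** For an unforced Leray–Hopf solution (`ν ≥ 0`, `T ≥ 0`)
and a level `c > 0`: `∫₀ᵀ |{x : c < |u τ x|}| dτ ≤ T · ∫‖u 0‖² / c²`; in particular the level-set
volume `V_c(T)` of the route is finite. [folklore] -/
theorem levelSetVolume_le {ν T : ℝ}
    {u : ℝ → EuclideanSpace ℝ (Fin 3) → EuclideanSpace ℝ (Fin 3)}
    (hLH : IsLerayHopfOn T ν 0 (u 0) u) (hν : 0 ≤ ν) (hT : 0 ≤ T) {c : ℝ} (hc : 0 < c) :
    (∫⁻ τ in Ioo 0 T, volume {x | c < ‖u τ x‖}) ≤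
      ENNReal.ofReal (T * ((∫ x, ‖u 0 x‖ ^ 2) / c ^ 2)) := by
  -- slice by slice
  have hslice : ∀ τ ∈ Ioo 0 T, volume {x | c < ‖u τ x‖} ≤
      ENNReal.ofReal ((∫ x, ‖u 0 x‖ ^ 2) / c ^ 2) := by
    intro τ hτ
    have hτ' : τ ∈ Icc 0 T := Ioo_subset_Icc_self hτ
    have hmeas : AEMeasurable (fun x => ‖u τ x‖ₑ ^ 2) volume :=
      (hLH.memLp τ hτ').aestronglyMeasurable.enorm.pow_const 2
    have hsub : {x | c < ‖u τ x‖} ⊆ {x | ENNReal.ofReal (c ^ 2) ≤ ‖u τ x‖ₑ ^ 2} := by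
      intro x hx
      have hx' : c < ‖u τ x‖ := hx
      show ENNReal.ofReal (c ^ 2) ≤ ‖u τ x‖ₑ ^ 2
      rw [← ofReal_norm, ← ENNReal.ofReal_pow (norm_nonneg _)]
      exact ENNReal.ofReal_le_ofReal (by nlinarith [norm_nonneg (u τ x)])
    have hc2 : ENNReal.ofReal (c ^ 2) ≠ 0 := by
      rw [ENNReal.ofReal_ne_zero_iff]; positivity
    calc volume {x | c < ‖u τ x‖}
        ≤ volume {x | ENNReal.ofReal (c ^ 2) ≤ ‖u τ x‖ₑ ^ 2} := measure_mono hsub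
      _ ≤ (∫⁻ x, ‖u τ x‖ₑ ^ 2) / ENNReal.ofReal (c ^ 2) :=
          meas_ge_le_lintegral_div hmeas hc2 ENNReal.ofReal_ne_top
      _ ≤ ENNReal.ofReal (∫ x, ‖u 0 x‖ ^ 2) / ENNReal.ofReal (c ^ 2) := by
          gcongr
          exact lintegral_enorm_sq_le_of_lerayHopf hLH hν hτ'
      _ = ENNReal.ofReal ((∫ x, ‖u 0 x‖ ^ 2) / c ^ 2) := by
          rw [ENNReal.ofReal_div_of_pos (by positivity)]
  calc (∫⁻ τ in Ioo 0 T, volume {x | c < ‖u τ x‖})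
      ≤ ∫⁻ _ in Ioo 0 T, ENNReal.ofReal ((∫ x, ‖u 0 x‖ ^ 2) / c ^ 2) := by
        refine lintegral_mono_ae ?_
        filter_upwards [ae_restrict_mem measurableSet_Ioo] with τ hτ
        exact hslice τ hτ
    _ = ENNReal.ofReal ((∫ x, ‖u 0 x‖ ^ 2) / c ^ 2) * volume (Ioo (0 : ℝ) T) :=
        setLIntegral_const _ _
    _ = ENNReal.ofReal (T * ((∫ x, ‖u 0 x‖ ^ 2) / c ^ 2)) := by
        rw [Real.volume_Ioo, sub_zero, mul_comm, ← ENNReal.ofReal_mul hT]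

/-! ### The threshold: existence of a closing window -/

/-- For reals `a, b` and negative exponents `e₁, e₂`, `b (a M^{e₁} + M^{e₂}) ≤ 1` for some
`M ≥ max(M₀, 1)` (both powers tend to `0` at infinity). [folklore] -/
theorem exists_window_threshold (a b M₀ e₁ e₂ : ℝ) (he₁ : e₁ < 0) (he₂ : e₂ < 0) :
    ∃ M : ℝ, M₀ ≤ M ∧ 1 ≤ M ∧ b * (a * M ^ e₁ + M ^ e₂) ≤ 1 := by
  have h1 : Tendsto (fun M : ℝ => M ^ e₁) atTop (𝓝 0) := by
    have := tendsto_rpow_neg_atTop (y := -e₁) (by linarith)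
    simpa using this
  have h2 : Tendsto (fun M : ℝ => M ^ e₂) atTop (𝓝 0) := by
    have := tendsto_rpow_neg_atTop (y := -e₂) (by linarith)
    simpa using this
  have h3 : Tendsto (fun M : ℝ => b * (a * M ^ e₁ + M ^ e₂)) atTop (𝓝 (b * (a * 0 + 0))) :=
    ((h1.const_mul a).add h2).const_mul b
  rw [mul_zero, zero_add, mul_zero] at h3
  have h4 : ∀ᶠ M in atTop, b * (a * M ^ e₁ + M ^ e₂) ≤ 1 :=
    (h3.eventually (ge_mem_nhds zero_lt_one))
  obtain ⟨M, hM⟩ := (h4.and ((eventually_ge_atTop M₀).and (eventually_ge_atTop 1))).exists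
  exact ⟨M, hM.2.1, hM.2.2, hM.1⟩

/-! ### The closure -/

/-- **Crux 3 of route LevelSetModeration (`LevelSetClosure`, stmt-NavierStokesRegularity-18150).**
A classical Leray–Hopf solution from a rapidly decaying datum with `|u₀| ≤ M₀/2` that obeys the
pressure-work bound of crux 2 with modulus `Λ` and exponent `m < 10/3` on all windows `M ≥ M₀`,
`c ∈ [M/2, M]`, is bounded on `[0,T)` (De Giorgi iteration for the speed in the volume
bookkeeping, closed by Stampacchia's lemma; Vasseur 2007, §4, Lemma 4 and Lemma 11).
[cite: Vasseur2007, §4] -/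
theorem levelSetClosure_proof : LevelSetClosure := by
  intro ν T hν hT u p hcl hLH hdec m Λ M₀ hm hM₀ hu0 hPW
  have hL : LevelSetEnergyInequality := levelSetModeration_levelSetEnergyInequality_proof
  -- abbreviations
  set KE : ℝ := VectorCalculus.kineticEnergy (u 0) with hKE
  set E2 : ℝ := ∫ x, ‖u 0 x‖ ^ 2 with hE2
  have hKE0 : 0 ≤ KE := kineticEnergy_nonneg (u 0)
  have hE20 : 0 ≤ E2 := integral_nonneg fun _ => sq_nonneg _
  set K : ℝ := (SNormLESNormFDerivOfEqConst ℝ (volume : Measure (EuclideanSpace ℝ (Fin 3))) 2 : ℝ)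
    with hK
  have hK0 : 0 ≤ K := NNReal.coe_nonneg _
  set Λ' : ℝ := max Λ 0 with hΛ'
  have hΛ'0 : 0 ≤ Λ' := le_max_right _ _
  set V : ℝ → ℝ≥0∞ := fun c => ∫⁻ τ in Ioo 0 T, volume {x | c < ‖u τ x‖} with hV
  set D : ℝ → ℝ≥0∞ := fun c => ∫⁻ τ in Ioo 0 T, ∫⁻ x, {x | c < ‖u τ x‖}.indicator
      (fun x => ENNReal.ofReal (‖fderiv ℝ (fun y => ‖u τ y‖) x‖ ^ 2)) x with hD
  set φ : ℝ → ℝ := fun c => (V c).toReal with hφ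
  have hφ0 : ∀ c, 0 ≤ φ c := fun c => ENNReal.toReal_nonneg
  -- regularity of the slices
  have hreg : ∀ τ ∈ Ioo 0 T, ContDiff ℝ 1 (u τ) ∧ MemLp (u τ) 2 volume := fun τ hτ =>
    ⟨(hcl.contDiff_velocity (Ioo_subset_Ico_self hτ)).of_le (by exact_mod_cast le_top),
      hLH.memLp τ (Ioo_subset_Icc_self hτ)⟩
  -- (F1) finiteness and monotonicity of the volume profile
  have hVfin : ∀ c, 0 < c → V c ≠ ∞ := fun c hc =>
    ne_top_of_le_ne_top ENNReal.ofReal_ne_top (levelSetVolume_le hLH hν.le hT.le hc)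
  have hVmono : ∀ a b, a ≤ b → V b ≤ V a := fun a b hab => by
    simp only [hV]
    exact lintegral_mono fun τ => measure_mono fun x (hx : b < ‖u τ x‖) => lt_of_le_of_lt hab hx
  -- (F2) finiteness and uniform bound of the dissipation
  have hDfin : ∀ c, 0 ≤ c → D c ≠ ∞ ∧ ν * (D c).toReal ≤ KE := fun c hc =>
    levelSetDissipation_ne_top hcl hLH hT hν.le hc
  -- (F3) slice energies
  have hEslice : ∀ τ ∈ Ioo 0 T, ∀ k, 0 ≤ k → ∫ x, (max (‖u τ x‖ - k) 0) ^ 2 ≤ E2 := by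
    intro τ hτ k hk
    obtain ⟨hint, hle⟩ := integral_norm_sq_le_of_lerayHopf hLH hν.le (Ioo_subset_Icc_self hτ)
    refine le_trans (integral_mono_of_nonneg (ae_of_all _ fun x => sq_nonneg _) hint
      (ae_of_all _ fun x => ?_)) hle
    have h0 : 0 ≤ max (‖u τ x‖ - k) 0 := le_max_right _ _
    have h1 : max (‖u τ x‖ - k) 0 ≤ ‖u τ x‖ :=
      max_le (by linarith [norm_nonneg (u τ x)]) (norm_nonneg _)
    exact pow_le_pow_left₀ h0 h1 2
  -- (F4) the De Giorgi input on a window, `Λ₊` form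
  have hDG : ∀ M c, M₀ ≤ M → M / 2 ≤ c → c ≤ M →
      (D c).toReal ≤ Λ' * M ^ m * φ c / ν ^ 2 ∧
      ∀ t ∈ Ico 0 T, ∫ x, (max (‖u t x‖ - c) 0) ^ 2 ≤ 4 * (Λ' * M ^ m * φ c) / ν := by
    intro M c hM hMc hcM
    have hMpos : 0 < M := lt_of_lt_of_le hM₀ hM
    have hc : 0 < c := by linarith
    obtain ⟨-, h2, h3⟩ := levelSetEnergy_le_of_pairingBound hL hν hT hcl hLH hdec hu0 hPW hM hMc
      hcM hc
    have hmax : max (Λ * M ^ m * (V c).toReal) 0 ≤ Λ' * M ^ m * φ c := by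
      refine max_le ?_ (by positivity)
      simp only [hφ]
      gcongr
      exact le_max_left _ _
    have hDreal : (D c).toReal ≤ Λ' * M ^ m * φ c / ν ^ 2 := by
      rw [le_div_iff₀ (by positivity)]
      have := h2
      simp only [hD] at this ⊢
      nlinarith
    refine ⟨hDreal, fun t ht => ?_⟩
    have h4 := h3 t ht
    have hDt0 : 0 ≤ 2 * ν * (D c).toReal := by positivity
    have h5 : 4 * max (Λ * M ^ m * (V c).toReal) 0 / ν ≤ 4 * (Λ' * M ^ m * φ c) / ν := by
      gcongr
    simp only [hD] at hDt0
    linarith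
  -- (F7) the autonomous two-level gain on a window
  set c₀ : ℝ := (4:ℝ) ^ (10 / 3 : ℝ) * K ^ 2 * (4 * Λ' / ν) ^ (2 / 3 : ℝ) * (Λ' / ν ^ 2) with hc₀
  have hc₀0 : 0 ≤ c₀ := by positivity
  have hgain : ∀ M k h, M₀ ≤ M → M / 2 ≤ k → k < h → h ≤ M →
      φ h ≤ (c₀ * (M ^ m) ^ (5 / 3 : ℝ) + 1) / (h - k) ^ (10 / 3 : ℝ) * φ k ^ (5 / 3 : ℝ) := by
    intro M k h hM hMk hkh hhM
    have hMpos : 0 < M := lt_of_lt_of_le hM₀ hM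
    have hk : 0 < k := by linarith
    have hXpos : 0 < M ^ m := Real.rpow_pos_of_pos hMpos m
    obtain ⟨hDk, hEk⟩ := hDG M k hM hMk (by linarith)
    set S : ℝ := 4 * (Λ' * M ^ m * φ k) / ν with hS
    have hS0 : 0 ≤ S := by positivity
    obtain ⟨-, hstep⟩ := levelVolume_twoLevel_le (u := u) (T := T) hk hkh hS0 hreg
      (fun τ hτ => hEk τ (Ioo_subset_Ico_self hτ)) (hDfin k hk.le).1
    have hpref : 0 ≤ (4 / (h - k)) ^ (10 / 3 : ℝ) * K ^ 2 * S ^ (2 / 3 : ℝ) := by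
      have : 0 ≤ 4 / (h - k) := div_nonneg (by norm_num) (by linarith)
      positivity
    have h1 : φ h ≤ (4 / (h - k)) ^ (10 / 3 : ℝ) * K ^ 2 * S ^ (2 / 3 : ℝ) *
        (Λ' * M ^ m * φ k / ν ^ 2) :=
      hstep.trans (mul_le_mul_of_nonneg_left hDk hpref)
    -- rewrite the right-hand side as `c₀ (M^m)^{5/3} (h-k)^{-10/3} φ(k)^{5/3}`
    have hhk : 0 ≤ h - k := by linarith
    have e1 : (4 / (h - k)) ^ (10 / 3 : ℝ) = (4:ℝ) ^ (10 / 3 : ℝ) / (h - k) ^ (10 / 3 : ℝ) :=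
      Real.div_rpow (by norm_num) hhk _
    have e2 : S ^ (2 / 3 : ℝ) =
        (4 * Λ' / ν) ^ (2 / 3 : ℝ) * (M ^ m) ^ (2 / 3 : ℝ) * φ k ^ (2 / 3 : ℝ) := by
      rw [hS, show 4 * (Λ' * M ^ m * φ k) / ν = (4 * Λ' / ν) * M ^ m * φ k by ring,
        Real.mul_rpow (by positivity) (hφ0 k), Real.mul_rpow (by positivity) hXpos.le]
    have e3 : (M ^ m) ^ (5 / 3 : ℝ) = (M ^ m) ^ (2 / 3 : ℝ) * M ^ m := by
      rw [show (5 / 3 : ℝ) = 2 / 3 + 1 by norm_num, Real.rpow_add hXpos, Real.rpow_one]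
    have e4 : φ k ^ (5 / 3 : ℝ) = φ k ^ (2 / 3 : ℝ) * φ k := by
      rw [show (5 / 3 : ℝ) = 2 / 3 + 1 by norm_num, Real.rpow_add' (hφ0 k) (by norm_num),
        Real.rpow_one]
    have h2 : (4 / (h - k)) ^ (10 / 3 : ℝ) * K ^ 2 * S ^ (2 / 3 : ℝ) *
        (Λ' * M ^ m * φ k / ν ^ 2) =
        c₀ * (M ^ m) ^ (5 / 3 : ℝ) / (h - k) ^ (10 / 3 : ℝ) * φ k ^ (5 / 3 : ℝ) := by
      rw [e1, e2, e3, e4, hc₀]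
      ring
    have h3 : c₀ * (M ^ m) ^ (5 / 3 : ℝ) / (h - k) ^ (10 / 3 : ℝ) * φ k ^ (5 / 3 : ℝ) ≤
        (c₀ * (M ^ m) ^ (5 / 3 : ℝ) + 1) / (h - k) ^ (10 / 3 : ℝ) * φ k ^ (5 / 3 : ℝ) := by
      apply mul_le_mul_of_nonneg_right _ (Real.rpow_nonneg (hφ0 k) _)
      exact div_le_div_of_nonneg_right (by linarith) (Real.rpow_nonneg hhk _)
    linarith [h1, h2.le, h3]
  -- (F9) the base of a window: one Sobolev step from level `M/4` with Leray–Hopf bounds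
  set B₀ : ℝ := K ^ 2 * E2 ^ (2 / 3 : ℝ) * (KE / ν) with hB₀
  have hB₀0 : 0 ≤ B₀ := by positivity
  have hbase : ∀ M, M₀ ≤ M → φ (M / 2) ≤ (16 / M) ^ (10 / 3 : ℝ) * B₀ := by
    intro M hM
    have hMpos : 0 < M := lt_of_lt_of_le hM₀ hM
    have hk : 0 < M / 4 := by positivity
    obtain ⟨-, hstep⟩ := levelVolume_twoLevel_le (u := u) (T := T) (h := M / 2) hk
      (by linarith) hE20 hreg (fun τ hτ => hEslice τ hτ (M / 4) hk.le) (hDfin (M / 4) hk.le).1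
    have hDk : (D (M / 4)).toReal ≤ KE / ν := by
      rw [le_div_iff₀ hν, mul_comm]
      exact (hDfin (M / 4) hk.le).2
    have hpref : 0 ≤ (4 / (M / 2 - M / 4)) ^ (10 / 3 : ℝ) * K ^ 2 * E2 ^ (2 / 3 : ℝ) := by
      have : 0 ≤ 4 / (M / 2 - M / 4) := div_nonneg (by norm_num) (by linarith)
      positivity
    have h1 := hstep.trans (mul_le_mul_of_nonneg_left hDk hpref)
    have e1 : 4 / (M / 2 - M / 4) = 16 / M := by
      field_simp; ring
    rw [e1] at h1
    simp only [hφ, hB₀]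
    linarith
  -- (F10) choice of the closing window `M`
  obtain ⟨M, hMM₀, hM1, hthr⟩ := exists_window_threshold c₀
    ((2:ℝ) ^ (10 / 3 : ℝ) * (2:ℝ) ^ (25 / 3 : ℝ) * ((16:ℝ) ^ (10 / 3 : ℝ) * B₀) ^ (2 / 3 : ℝ))
    M₀ (m * (5 / 3) - 50 / 9) (-(50 / 9)) (by linarith) (by norm_num)
  have hMpos : 0 < M := by linarith
  have hM0 : M₀ ≤ M := hMM₀
  -- the Stampacchia threshold on the window `[M/2, M]`
  have hsize : (c₀ * (M ^ m) ^ (5 / 3 : ℝ) + 1) * φ (M / 2) ^ (5 / 3 - 1 : ℝ) *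
      (2:ℝ) ^ ((10 / 3 : ℝ) * (5 / 3) / (5 / 3 - 1)) ≤ (M / 2) ^ (10 / 3 : ℝ) := by
    have eβ : (5 / 3 - 1 : ℝ) = 2 / 3 := by norm_num
    have eαβ : ((10 / 3 : ℝ) * (5 / 3) / (5 / 3 - 1)) = 25 / 3 := by norm_num
    rw [eαβ, eβ]
    -- `φ(M/2)^{2/3} ≤ (16^{10/3} B₀)^{2/3} M^{-20/9}`
    have hb := hbase M hM0
    have hφ23 : φ (M / 2) ^ (2 / 3 : ℝ) ≤
        ((16:ℝ) ^ (10 / 3 : ℝ) * B₀) ^ (2 / 3 : ℝ) * M ^ (-(20 / 9) : ℝ) := by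
      have h1 : φ (M / 2) ^ (2 / 3 : ℝ) ≤ ((16 / M) ^ (10 / 3 : ℝ) * B₀) ^ (2 / 3 : ℝ) :=
        Real.rpow_le_rpow (hφ0 _) hb (by norm_num)
      have h2 : ((16 / M) ^ (10 / 3 : ℝ) * B₀) ^ (2 / 3 : ℝ) =
          ((16:ℝ) ^ (10 / 3 : ℝ) * B₀) ^ (2 / 3 : ℝ) * M ^ (-(20 / 9) : ℝ) := by
        rw [Real.div_rpow (by norm_num) hMpos.le, div_mul_eq_mul_div,
          Real.div_rpow (by positivity) (Real.rpow_nonneg hMpos.le _),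
          ← Real.rpow_mul hMpos.le, Real.rpow_neg hMpos.le, div_eq_mul_inv]
        norm_num
      rw [h2] at h1
      exact h1
    -- `(M^m)^{5/3} = M^{m·5/3}` and the bookkeeping of the powers of `M`
    have eX : (M ^ m) ^ (5 / 3 : ℝ) = M ^ (m * (5 / 3)) := (Real.rpow_mul hMpos.le m _).symm
    have eM1 : M ^ (m * (5 / 3)) * M ^ (-(20 / 9) : ℝ) =
        M ^ (m * (5 / 3) - 50 / 9) * M ^ (10 / 3 : ℝ) := by
      rw [← Real.rpow_add hMpos, ← Real.rpow_add hMpos]; ring_nf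
    have eM2 : M ^ (-(20 / 9) : ℝ) = M ^ (-(50 / 9) : ℝ) * M ^ (10 / 3 : ℝ) := by
      rw [← Real.rpow_add hMpos]; norm_num
    have eM3 : (M / 2) ^ (10 / 3 : ℝ) = M ^ (10 / 3 : ℝ) / (2:ℝ) ^ (10 / 3 : ℝ) :=
      Real.div_rpow hMpos.le (by norm_num) _
    have h2pos : (0:ℝ) < (2:ℝ) ^ (10 / 3 : ℝ) := by positivity
    have h225 : (0:ℝ) ≤ (2:ℝ) ^ (25 / 3 : ℝ) := by positivity
    have hM103 : (0:ℝ) ≤ M ^ (10 / 3 : ℝ) := by positivity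
    have hCpos : 0 ≤ c₀ * (M ^ m) ^ (5 / 3 : ℝ) + 1 := by positivity
    -- the main estimate
    set b₁ : ℝ := ((16:ℝ) ^ (10 / 3 : ℝ) * B₀) ^ (2 / 3 : ℝ) with hb₁
    have hb₁0 : 0 ≤ b₁ := by positivity
    calc (c₀ * (M ^ m) ^ (5 / 3 : ℝ) + 1) * φ (M / 2) ^ (2 / 3 : ℝ) * (2:ℝ) ^ (25 / 3 : ℝ)
        ≤ (c₀ * (M ^ m) ^ (5 / 3 : ℝ) + 1) * (b₁ * M ^ (-(20 / 9) : ℝ)) *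
            (2:ℝ) ^ (25 / 3 : ℝ) := by gcongr
      _ = ((2:ℝ) ^ (10 / 3 : ℝ) * (2:ℝ) ^ (25 / 3 : ℝ) * b₁ *
            (c₀ * M ^ (m * (5 / 3) - 50 / 9) + M ^ (-(50 / 9) : ℝ))) *
            (M ^ (10 / 3 : ℝ) / (2:ℝ) ^ (10 / 3 : ℝ)) := by
          rw [eX]
          have : (c₀ * M ^ (m * (5 / 3)) + 1) * (b₁ * M ^ (-(20 / 9) : ℝ)) =
              b₁ * (c₀ * (M ^ (m * (5 / 3)) * M ^ (-(20 / 9) : ℝ)) + M ^ (-(20 / 9) : ℝ)) := by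
            ring
          rw [this, eM1, eM2]
          field_simp
      _ ≤ 1 * (M ^ (10 / 3 : ℝ) / (2:ℝ) ^ (10 / 3 : ℝ)) := by
          apply mul_le_mul_of_nonneg_right hthr (by positivity)
      _ = (M / 2) ^ (10 / 3 : ℝ) := by rw [one_mul, eM3]
  -- Stampacchia on the window `[M/2, M]`
  have hzero : φ (M / 2 + M / 2) = 0 := by
    refine LevelSetClosure.stub_stampacchia φ (M / 2) (M / 2) (c₀ * (M ^ m) ^ (5 / 3 : ℝ) + 1) (10 / 3)
      (5 / 3) (by positivity) (by norm_num) (by norm_num) (by positivity)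
      (fun h _ => hφ0 h) ?_ ?_ hsize
    · intro a ha b _ hab
      have ha' : 0 < a := lt_of_lt_of_le (by positivity) (show M / 2 ≤ a from ha)
      simp only [hφ]
      exact ENNReal.toReal_mono (hVfin a ha') (hVmono a b hab)
    · intro k h hk hkh hh
      exact hgain M k h hM0 hk hkh (by linarith)
  rw [add_halves] at hzero
  have hVM : V M = 0 := by
    have h := (ENNReal.toReal_eq_zero_iff _).1 hzero
    exact h.resolve_right (hVfin M hMpos)
  -- endgame: open-null-empty on `(0,T)`, the datum at `t = 0`
  have hcont : ContinuousOn (uncurry u) (Ico 0 T ×ˢ univ) := hcl.smooth_velocity.continuousOn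
  have hpos := LevelSetClosure.tools_openNullEmpty T M u hcont hVM
  refine ⟨M, fun t ht x => ?_⟩
  rcases eq_or_lt_of_le ht.1 with h0 | h0
  · rw [← h0]
    exact (hu0 x).trans (by linarith)
  · exact hpos t ⟨h0, ht.2⟩ x

end Summit.NavierStokesRegularity.NavierStokesRegularity.Theorems

end
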